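import Summits.HodgeConjecture.CorCM.QuarticCMTypeSliceBiquadratic
import Summits.HodgeConjecture.CorCM.QuadraticCMTypeSlice
import HarnessLib

/-!
# The slice of `HC_CM` over CM fields of degree `≤ 4` — one statement, no hypothesis

COR-CM (cell `pub-hodgecm2`), seat b24, count-neutral lane QUARTIC-SLICE: the junction of `CorCM/QuadraticCMTypeSlice.lean`
(`[K:ℚ] = 2`) and `CorCM/QuarticCMTypeSliceBiquadratic.lean` (`[K:ℚ] = 4`).  A CM field is totally complex, so its degree
`[K:ℚ] = 2 · #{complex places}` is even (`finrank_eq_two_mul_nrComplexPlaces`); hence `[K:ℚ] ≤ 4` means `2` or `4`: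
**`hodgeConjectureFor_cmProdAV_of_finrank_le_four`**, **`hodgeConjectureFor_of_isOfCMType_of_endAlgebra_of_finrank_le_four`**,
**`cmAbelianHodge_slice_of_finrank_le_four`** — for every CM field `K` of degree `≤ 4` and every complex abelian variety of CM
type all of whose simple abelian subvarieties have `End⁰ →+* K`, the Hodge conjecture holds; theorems only, unconditional.

## References
* [Gordon1999HodgeAVSurvey] B. B. Gordon, *A survey of the Hodge conjecture for abelian varieties*, §3, 7.5, 10.10.
* [MoonenZarhin1999LowDim] B. Moonen, Yu. Zarhin, Math. Ann. 315 (1999) 711–733.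
-/

noncomputable section

open CategoryTheory NumberField AlgebraicGeometry
open Literature.AlgebraicGeometry Literature.AlgebraicGeometry.Motives Literature.AlgebraicGeometry.HodgeTheory
open Literature.AlgebraicGeometry.Milne1999
open Literature.NumberTheory.Automorphic.PicardCM (CMAbelianVarietyRealised)
open Summit.HodgeConjecture.CorCM.Domination

namespace Summit.HodgeConjecture.CorCM.QuarticCM

variable {K : Type} [Field K] [NumberField K] [IsCMField K]

/-- **The degree of a CM field is twice its number of complex places** (no real place). [folklore] -/
theorem finrank_eq_two_mul_nrComplexPlaces : Module.finrank ℚ K = 2 * InfinitePlace.nrComplexPlaces K := by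
  rw [← InfinitePlace.card_add_two_mul_card_eq_rank, IsTotallyComplex.nrRealPlaces_eq_zero, zero_add]

/-- A CM field of degree `≤ 4` is imaginary quadratic or quartic. [folklore] -/
theorem finrank_eq_two_or_eq_four (h : Module.finrank ℚ K ≤ 4) : Module.finrank ℚ K = 2 ∨ Module.finrank ℚ K = 4 := by
  have h0 : 0 < Module.finrank ℚ K := Module.finrank_pos
  have h2 := finrank_eq_two_mul_nrComplexPlaces (K := K)
  omega

/-- **HC for every `∏_j A_{(K,Θ_j)}` over a CM field of degree `≤ 4`**, every realisation record, no hypothesis.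
[cite: Gordon1999HodgeAVSurvey, §3, 7.5 and 10.10] -/
theorem hodgeConjectureFor_cmProdAV_of_finrank_le_four (h₃ : CMAbelianVarietyRealised) (h : Module.finrank ℚ K ≤ 4)
    (n : ℕ) (Θ : Fin (n + 1) → CMType K) : HodgeConjectureFor (cmProdAV K h₃ n Θ).dim (cmProdAV K h₃ n Θ).X := by
  rcases finrank_eq_two_or_eq_four h with h2 | h4
  · exact hodgeConjectureFor_cmProdAV_quadratic h₃ h2 n Θ
  · exact hodgeConjectureFor_cmProdAV_quartic h₃ h4 n Θ

/-- **HC for every complex abelian variety of CM type whose simple abelian subvarieties have `End⁰ →+* K`, `K` a CM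
field of degree `≤ 4`** — unconditional. [cite: Gordon1999HodgeAVSurvey, §3, 7.5 and 10.10]
[cite: MoonenZarhin1999LowDim, section "Hodge groups of simple abelian surfaces of CM-type"] -/
theorem hodgeConjectureFor_of_isOfCMType_of_endAlgebra_of_finrank_le_four (h : Module.finrank ℚ K ≤ 4)
    {A : AbelianVariety ℂ} (hCM : IsOfCMType A)
    (hend : ∀ (B : AbelianVariety ℂ) (f : B ⟶ A), IsClosedImmersion (AbelianVariety.Hom.toSchemeHom f) →
      AbelianVariety.IsSimple B → 0 < B.dim → Nonempty (B.endAlgebra →+* K)) :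
    HodgeConjectureFor A.dim A.X := by
  rcases finrank_eq_two_or_eq_four h with h2 | h4
  · exact hodgeConjectureFor_of_isOfCMType_of_endAlgebra_quadratic h2 hCM hend
  · exact hodgeConjectureFor_of_isOfCMType_of_endAlgebra_quartic h4 hCM hend

/-- **`CMAbelianHodge` (= `HC_CM`) restricted to a CM field of degree `≤ 4`, binders VERBATIM, no further hypothesis.**
[cite: Gordon1999HodgeAVSurvey, §3, 7.5 and 10.10] -/
theorem cmAbelianHodge_slice_of_finrank_le_four (h : Module.finrank ℚ K ≤ 4) :
    ∀ A : AbelianVariety ℂ, IsSmoothProjective A.dim A.X →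
      (∃ S : Subalgebra ℚ A.endAlgebra,
        IsReduced ↥S ∧ (∀ x ∈ S, ∀ y ∈ S, x * y = y * x) ∧ Module.finrank ℚ ↥S = 2 * A.dim) →
      (∀ (B : AbelianVariety ℂ) (f : B ⟶ A), IsClosedImmersion (AbelianVariety.Hom.toSchemeHom f) →
        AbelianVariety.IsSimple B → 0 < B.dim → Nonempty (B.endAlgebra →+* K)) →
      HodgeConjectureFor A.dim A.X :=
  fun _ _ hCM hend => hodgeConjectureFor_of_isOfCMType_of_endAlgebra_of_finrank_le_four h hCM hend

end Summit.HodgeConjecture.CorCM.QuarticCM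

end
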